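import Mathlib

/-!
# Camp character law — the finite-field kernel (engine A, gen 44; DERIVATION-GK-A §5ae)

certified instances and evidence bearing on the general Hodge conjecture; no claim.

Def-free computational anchors (`decide`) for the one finite fact used in §5ae:
in `F₉ = F₃(i)` (`i² = -1`), written as coordinate pairs `(a, b) ↦ a + b i` over `ZMod 3`
with product `(a,b)·(c,d) = (ac - bd, ad + bc)` and norm `N(a,b) = a² + b²`,
a non-zero element is a square of a unit iff its norm is `1`; the squares are `{±1, ±i}`;
and for a unit `u` and `c ∈ {±1, ±i}` the element `ū²·c` (`= N(u)²·u⁻²·c`, same class as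
`u⁻² c`) lies in the class `{±1}` exactly when `c` does iff `N(u) = 1` — i.e. conjugation
by a quaternion `α` flips the local class iff `nrd α ≢ 1 (mod 3)`.
-/

namespace Summit.HodgeConjecture.HodgeConjecture.HodgeLocus.Census.CampCharacterF9

/-- A non-zero element of `F₉` is the square of a non-zero element iff its norm is `1`. -/
theorem square_iff_norm_one :
    ∀ x : ZMod 3 × ZMod 3, x ≠ (0, 0) →
      ((∃ y : ZMod 3 × ZMod 3, y ≠ (0, 0) ∧
          (y.1 * y.1 - y.2 * y.2, y.1 * y.2 + y.2 * y.1) = x) ↔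
        x.1 * x.1 + x.2 * x.2 = 1) := by
  decide

/-- The squares of `F₉ˣ` are exactly `{±1, ±i}` = `{(1,0), (2,0), (0,1), (0,2)}`. -/
theorem squares_list :
    ∀ x : ZMod 3 × ZMod 3, x ≠ (0, 0) →
      ((∃ y : ZMod 3 × ZMod 3, y ≠ (0, 0) ∧
          (y.1 * y.1 - y.2 * y.2, y.1 * y.2 + y.2 * y.1) = x) ↔
        (x = (1, 0) ∨ x = (2, 0) ∨ x = (0, 1) ∨ x = (0, 2))) := by
  decide

/-- The norm `a² + b²` is multiplicative for the product `(ac - bd, ad + bc)` over `ZMod 3`. -/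
theorem norm_mul :
    ∀ x y : ZMod 3 × ZMod 3,
      (x.1 * y.1 - x.2 * y.2) * (x.1 * y.1 - x.2 * y.2) +
          (x.1 * y.2 + x.2 * y.1) * (x.1 * y.2 + x.2 * y.1) =
        (x.1 * x.1 + x.2 * x.2) * (y.1 * y.1 + y.2 * y.2) := by
  decide

/-- Character-law kernel: for a unit `u = (a,b)` of `F₉` and `c ∈ {±1, ±i}`, put
`ū = (a,-b)`, `ū² = (a² - b², -2ab) =: (s, t)` and `v = ū²·c = (s c₁ - t c₂, s c₂ + t c₁)`;
then (`v ∈ {±1}` ↔ `c ∈ {±1}`) iff `N(u) = a² + b² = 1`. -/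
theorem class_flip_iff_norm :
    ∀ u c : ZMod 3 × ZMod 3, u ≠ (0, 0) →
      (c = (1, 0) ∨ c = (2, 0) ∨ c = (0, 1) ∨ c = (0, 2)) →
      (let s : ZMod 3 := u.1 * u.1 - u.2 * u.2
       let t : ZMod 3 := -(u.1 * u.2 + u.2 * u.1)
       let v : ZMod 3 × ZMod 3 := (s * c.1 - t * c.2, s * c.2 + t * c.1)
       ((v = (1, 0) ∨ v = (2, 0)) ↔ (c = (1, 0) ∨ c = (2, 0))) ↔
        u.1 * u.1 + u.2 * u.2 = 1) := by
  decide

end Summit.HodgeConjecture.HodgeConjecture.HodgeLocus.Census.CampCharacterF9
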